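import Mathlib
import Literature.MathematicalPhysics.QuantumFieldTheory.Balaban1983to89.B7Ineq148

/-!
# `Balaban1983to89.B13Ineq140` — kernel proof of the Taylor-coefficient estimate (1.40) of B13 from (1.39)

CITATION HEADER (lean-in-tree rule 2026-08-18).  T. Bałaban, *Renormalization group approach to lattice gauge field
theories. II. Cluster expansions*, Commun. Math. Phys. **116**, 1–22 (1988) [Balaban1988RG2Cluster] (cell paper B13;
held `paper:balaban1988-cmp116-rg-ii-cluster`, journal page = PDF page), Sect. 1 pp. 9–11, render-checked 2026-08-18 on
`b2b-balaban-ref1/pages/1988-cmp116-rg-II-cluster/1988-cmp116-rg-II-cluster-p009-x2.png`, `…-p010-x2.png`,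
`…-p011-x2.png` (read as images, not from the OCR layer); p. 18 (2.30) on `…-p018-x2.png` (quoted via the sibling
module `…Balaban1983to89.TreeLength`, which kernel-proves its upper half).  The paper is UNDER ADJUDICATION by the audit
cell `pub-balaban`; nothing of it is asserted here: every printed input enters as an explicit hypothesis, and what is
proved is proved by the kernel from Mathlib (Cauchy's estimate `Complex.norm_deriv_le_of_forall_mem_sphere_norm_le`,
analyticity of the Fréchet derivative `AnalyticOnNhd.fderiv_of_isOpen`).  This module is a NEW sibling of `B13.lean`
(units r2/b13), `B13Closing.lean`, `B7Ineq148.lean` (whose pattern — a polynomial bound on a polydisc ⇒ a derivative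
bound by a Cauchy estimate on a complex line — it iterates once more, reusing its line chain rule `B7Ineq148.hasDerivAt_line`); it imports Mathlib and `B7Ineq148` and
modifies nothing.
Unit `b2b-balaban-pv20-g2` (surge node prover #20, gen 2); cell records GAPS C-B13-01 (the step (1.39) ⇒ (1.40) was
certified BY HAND, restriction census R10), C-pv20-4 (this kernel certificate), `HOME/BETA/AN4.md` §4 (P1)(i).

WHAT IS PRINTED (verbatim from the renders).
* p. 10, before (1.37): *"It is connected with the factor 1/g_k² at many terms in this function. We have to cancel this
  factor, and this implies that we can get a bounded polynomial in B only, not the absolute bound of the type (1.36).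
  Let us discuss it on the most important example of the expression (1/g_k²)V(H₁B′), where B′ is given by (I.3.2)."*
* p. 10, after (1.38): *"The above expression is localized in the interior of Y, with respect to U, J, B′ or B. It is
  an analytic function of (U, J) in the space U′ᶜ_{k+1}(T_η, α′₀, α′₁), and of B′ in the domain
  {B′ : e^{16κ₁}|B′| ≦ a₁ on Y}, as it follows from the considerations of the beginning of the section. The
  underintegral expression is analytic in σ(Y) on the polydisc |σ(Y)| ≦ e^{κ₁}. The estimates (33), (37), (55), (57),
  (58) [15] imply the bound  |(1.38)| ≦ C₃(e^{16κ₁}|B′|)³M⁴exp(−(κ₁ − 1)M⁻⁴|Y∖□|), (1.39)  where C₃ is an absolute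
  constant. To cancel the factor 1/g_k² we expand (1.38) with respect to B′ up to the second order. The terms of
  zeroth and first order vanish, and the second order term is written as a quadratic form with coefficients given by
  second order derivatives of the function (1.38). The coefficients satisfy the bound
  |∫₀¹ dt(1 − t) ∂²/(∂B′_μ(x)∂B′_ν(y)) ((1.38) with B′ replaced by tB′)|
  ≦ ½C₃3³e^{7·8κ₁}|B′| exp(−⅛(κ₁ − 1)d_k(Y) − ½(κ₁ − 1)M⁻⁴|Y|), (1.40)  if e^{16κ₁}|B′| ≦ ⅓a₁."*
* p. 10 l.-1 – p. 11 l.1–4: *"Taking B′ as in (1.19) we obtain the above bound with |B′| replaced by C₁ε₁. We fix a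
  localization domain Y and we sum up all the expressions (1.38) with the domain Y, i.e. we sum over all admissible
  □ ⊂ Y. This yields an expression satisfying the bounds (1.39), (1.40) with the additional factor M⁻⁴|Y| ≦
  exp M⁻⁴|Y|."*
* p. 11, Lemma 2, (1.43): *"The matrix elements of the operator of the quadratic form satisfy the bound
  |Q(Y, B, b, b′)| ≦ C₃ε₁M⁴ exp C₂κ₁ exp(−⅛(κ₁ − 1)d_k(Y) − ½(κ₁ − 1)M⁻⁴|Y|), (1.43)"*.
* p. 18, (2.30): *"In connection with this notice the following useful inequality
  (3·2³)⁻¹M⁻⁴|Y| ≦ d_k(Y) ≦ M⁻⁴|Y| − 1 (2.30) holding for localization domains Y ∈ 𝐃_k."* (M⁻⁴|Y| = the number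
  of cubes of π_k in Y; the upper half is the theorem `TreeLength.treeLen_le_card_sub_one` of the sibling module.)

WHAT THIS FILE CERTIFIES.  The concrete model of the printed objects: the variables of (1.38) are the components of the
field B′ on the bonds of Y (values in the Lie algebra), so a configuration is a point of a complex normed space `E`
(e.g. `ι → 𝔤ᶜ` with Mathlib's sup norm, for which the polydisc {e^{16κ₁}|B′(b)| ≦ a₁ ∀ b} IS the sup-norm ball and a
unit coordinate vector `Pi.single b e`, ‖e‖ = 1, has norm 1), (1.38) is a function `Fk : E → F` into a complex normed
space (`F = ℂ` in print); *"analytic … of B′ in the domain"* = `AnalyticOnNhd ℂ Fk (ball 0 (rad κ₁ a₁))`,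
`rad κ₁ a₁ = a₁e^{−16κ₁}` (the OPEN polydisc — weaker than the printed closed one, so every theorem below applies to
the printed situation); the printed second partial derivative along the unit coordinate directions `u = ∂/∂B′_μ(x)`,
`v = ∂/∂B′_ν(y)` is `d2 Fk p u v = D(z ↦ DFk(z)v)(p)u` (for analytic `Fk` this is the iterated line derivative
`∂_s∂_r Fk(p + su + rv)|₀`, `pd2_eq_d2`), and the printed coefficient is
`coeff140 Fk B′ u v = ∫₀¹ (1 − t) • d2 Fk (tB′) u v dt` (the (1 − t)dt-weighted second derivative OF (1.38) AT tB′, the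
integral-remainder coefficient of Taylor's formula; the literal reading "∂² of the function B′ ↦ (1.38)(tB′)" only
inserts a factor t² ≤ 1 and is covered a fortiori).
* `norm_fderiv_apply_le_of_bound` — ONE CAUCHY STEP [folklore]: `f` complex-differentiable on `ball 0 R`, ‖f‖ ≤ B on
  ‖z‖ ≤ ρ₁ < R, ‖p‖ ≤ ρ₀ < ρ₁ ⇒ ‖Df(p)v‖ ≤ B‖v‖/(ρ₁ − ρ₀) (Cauchy on the line p + tv, |t| ≤ (ρ₁ − ρ₀)/‖v‖).
* `norm_d2_le_of_bound`, `norm_d3_le_of_bound` — the step NESTED (the derivative of an analytic map is analytic,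
  `analyticOnNhd_fderiv_apply`): shells ρ₀ < ρ₁ < ρ₂ (< ρ₃) give ‖∂_u∂_v f(p)‖ ≤ B‖u‖‖v‖/((ρ₂ − ρ₁)(ρ₁ − ρ₀)) etc.
* `norm_d2_le_of_cubic` — under the CUBIC bound ‖f z‖ ≤ K‖z‖³ on `ball 0 R` (the shape of (1.39)): for ‖p‖ ≤ β,
  3β ≤ R: ‖∂_u∂_v f(p)‖ ≤ 27Kβ‖u‖‖v‖ (shells β, 2β, 3β, sup K(3β)³; the closed third-ball by a limit of radii).
* `norm_coeff140_le` — hence ‖coeff140 f B′ u v‖ ≤ ½·27·K‖B′‖ for 3‖B′‖ ≤ R, ‖u‖, ‖v‖ ≤ 1 (∫₀¹(1 − t)dt = ½).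
* `ineq140_sharp` — with the printed constants, K = C₃e^{3·16κ₁}M⁴exp(−(κ₁ − 1)M⁻⁴|Y∖□|) from (1.39):
  ‖coeff‖ ≤ ½C₃3³e^{48κ₁}·M⁴exp(−(κ₁ − 1)M⁻⁴|Y∖□|)·|B′| if e^{16κ₁}|B′| ≤ ⅓a₁ — the numerals ½ and 3³ of (1.40)
  reproduced EXACTLY (radii |B′| in each of the two variables: the three shells use the domain up to 3|B′|, which is
  precisely the printed proviso e^{16κ₁}|B′| ≦ ⅓a₁), with e^{48κ₁} = (e^{16κ₁})³.
* `absorb140`, `ineq140Printed_of_139` — the PRINTED right side of (1.40) (e^{7·8κ₁} = e^{48κ₁}·e^{8κ₁}, exponents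
  −⅛(κ₁ − 1)d_k(Y) − ½(κ₁ − 1)M⁻⁴|Y|) follows by bookkeeping from M⁻⁴|Y∖□| = M⁻⁴|Y| − 1 under TWO EXPLICIT
  HYPOTHESES that the print leaves implicit: (R10) M⁴e^{κ₁−1} ≤ e^{8κ₁} (cell GAPS C-B13-01: *"Numeral 7·8κ₁ in (1.40)
  reproduced modulo the mild implicit restriction 4 ln M ≲ 7κ₁"* — here it is the hypothesis `hR10`, not absorbed
  silently), and d_k(Y) ≤ 4·M⁻⁴|Y| (⇐ the printed (2.30) upper half d_k(Y) ≦ M⁻⁴|Y| − 1, `four_n_of_230`), κ₁ ≥ 1.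
* `ineq140_C₁ε₁`, `norm_sum_le_exp_card_mul` — the two sentences of p. 11 l.1–4 (|B′| ↦ C₁ε₁; the sum over the
  ≤ M⁻⁴|Y| admissible cubes □ ⊂ Y costs a factor M⁻⁴|Y| ≦ exp M⁻⁴|Y|).
PART B (cell document `HOME/BETA/AN4.md` §4 (P1)(i), an [analysis]-tagged claim of the cell, here KERNEL-CHECKED from the
same printed inputs; it is NOT a statement of the paper): the g_k-derivative of the cancelled term (1/g_k²)V(g_kY).
* `euler2 V w = DV(w)w − 2V(w)` ((w∂_w − 2)V) and `hasDerivAt_inv_sq_smul`: d/dg [g⁻²V(gY)] = g⁻³·((w∂_w − 2)V)(gY)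
  (g ≠ 0; complex g, the real coupling being the restriction).
* `norm_euler2_le`, `analyticOnNhd_euler2` — (w∂_w − 2)V is analytic where V is and inherits the cubic bound with the
  ABSOLUTE factor 35/4 on 3‖w‖/2 < R.
* `norm_d3_le_of_cubic`, `norm_coeff3_le`, `an4_P1i` — third derivatives of a function with a cubic bound are bounded
  by an ABSOLUTE multiple of K (64K on the quarter-ball), hence the third-order integral-remainder coefficients
  ∫₀¹½(1 − t)²∂³W(tB′)dt of W = (w∂_w − 2)(1.38) are ≤ (280/3)·C₃e^{48κ₁}M⁴exp(−(κ₁ − 1)M⁻⁴|Y∖□|) for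
  e^{16κ₁}|B′| ≤ a₁/6 — NO factor |B′| → C₁ε₁ survives (AN4 (P1)(i): *"at third order none remains"*).  What Part B does
  NOT touch is AN4's located open estimate itself ((P1)(ii), the polynomial-INSERTION version of B13 (2.12)–(2.13) with
  k-uniform constants): value = kernel certificate of a printed bookkeeping step + a narrowing of a located gap, NOT
  summit progress.
NOT certified here (printed inputs = hypotheses): the analyticity of (1.38) in B′ and the bound (1.39) themselves
(their inputs are (33), (37), (55), (57), (58) of [15] = B11, by reference: GAPS G-B13-01…05), Taylor's formula with
integral remainder (the sentence "we expand (1.38) … up to the second order", [folklore], not re-derived), the identity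
M⁻⁴|Y∖□| = M⁻⁴|Y| − 1 for an admissible cube □ ⊂ Y (encoded by instantiating nYc := nY − 1), and (2.30).
-/

noncomputable section

namespace Literature.MathematicalPhysics.QuantumFieldTheory.Balaban1983to89.B13Ineq140

open Metric Set Filter
open scoped Topology
open B7Ineq148 (hasDerivAt_line)

section General

variable {E F : Type*} [NormedAddCommGroup E] [NormedSpace ℂ E]
  [NormedAddCommGroup F] [NormedSpace ℂ F]

/-! ## Derivatives along directions and the printed second partial derivative -/

/-- The mixed second derivative of `f` at `p` along the directions `v` (inner) and `u` (outer):
`d2 f p u v = D(z ↦ Df(z) v)(p) u` — for the unit coordinate directions `u = ∂/∂B′_μ(x)`, `v = ∂/∂B′_ν(y)` this is the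
printed *"∂²/(∂B′_μ(x)∂B′_ν(y))"* of (1.40), p. 10 (see `pd2_eq_d2`). [cite: Balaban1988RG2Cluster, (1.40) p.10] -/
def d2 (f : E → F) (p u v : E) : F :=
  fderiv ℂ (fun z => fderiv ℂ f z v) p u

/-- The third derivative along `x` (outermost), `u`, `v`: `d3 f p x u v = D(z ↦ d2 f z u v)(p) x` (Part B). [folklore] -/
def d3 (f : E → F) (p x u v : E) : F :=
  fderiv ℂ (fun z => d2 f z u v) p x

/-- The printed iterated partial derivative, literally: `∂_s ∂_r f(p + s u + r v)` at `s = r = 0` along complex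
coordinate lines (B′ has values in the complexified Lie algebra, p. 10: analytic "of B′ in the domain
{B′ : e^{16κ₁}|B′| ≦ a₁ on Y}"). [cite: Balaban1988RG2Cluster, (1.40) p.10] -/
def pd2 (f : E → F) (p u v : E) : F :=
  deriv (fun s : ℂ => deriv (fun r : ℂ => f (p + s • u + r • v)) 0) 0

/-- The line derivative at `0` is the Fréchet derivative applied to the direction. [folklore] -/
theorem deriv_line_eq_fderiv {f : E → F} {A : E} (hf : DifferentiableAt ℂ f A) (v : E) :
    deriv (fun r : ℂ => f (A + r • v)) 0 = fderiv ℂ f A v := by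
  have hfA : HasFDerivAt f (fderiv ℂ f A) (A + (0 : ℂ) • v) := by
    simpa using hf.hasFDerivAt
  exact (hasDerivAt_line hfA).deriv

/-- The printed iterated partial derivative IS `d2`: if `f` is complex-differentiable on an open set `U ∋ p` and
`z ↦ Df(z)v` is differentiable at `p` (both automatic for `f` analytic on `U`, `analyticOnNhd_fderiv_apply`), then
`∂_s∂_r f(p + su + rv)|₀ = d2 f p u v`. [folklore] -/
theorem pd2_eq_d2 {f : E → F} {U : Set E} (hU : IsOpen U) (hf : DifferentiableOn ℂ f U) {p : E} (hp : p ∈ U)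
    (u v : E) (hg : DifferentiableAt ℂ (fun z => fderiv ℂ f z v) p) :
    pd2 f p u v = d2 f p u v := by
  unfold pd2 d2
  have hnhds : ∀ᶠ s : ℂ in 𝓝 0, p + s • u ∈ U := by
    have hc : Continuous (fun s : ℂ => p + s • u) := by fun_prop
    have h0 : p + (0 : ℂ) • u ∈ U := by simpa using hp
    exact hc.continuousAt.preimage_mem_nhds (hU.mem_nhds h0)
  have heq : (fun s : ℂ => deriv (fun r : ℂ => f (p + s • u + r • v)) 0)
      =ᶠ[𝓝 0] (fun s : ℂ => fderiv ℂ f (p + s • u) v) := by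
    filter_upwards [hnhds] with s hs
    exact deriv_line_eq_fderiv (hf.differentiableAt (hU.mem_nhds hs)) v
  rw [heq.deriv_eq]
  have hg' : HasFDerivAt (fun z => fderiv ℂ f z v) (fderiv ℂ (fun z => fderiv ℂ f z v) p)
      (p + (0 : ℂ) • u) := by
    simpa using hg.hasFDerivAt
  exact (hasDerivAt_line hg').deriv

/-! ## One Cauchy step, and the step nested -/

/-- **One Cauchy estimate on a complex line.**  If `f` is complex-differentiable on `ball 0 R`, `‖f z‖ ≤ B` whenever
`‖z‖ ≤ ρ₁` (`ρ₁ < R`), and `‖p‖ ≤ ρ₀ < ρ₁`, then `‖Df(p) v‖ ≤ B‖v‖/(ρ₁ − ρ₀)` for every direction `v`: Cauchy's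
inequality for `t ↦ f(p + t•v)` on the disc `|t| ≤ (ρ₁ − ρ₀)/‖v‖`, whose image lies in `{‖z‖ ≤ ρ₁}`. [folklore] -/
theorem norm_fderiv_apply_le_of_bound {f : E → F} {R ρ₀ ρ₁ B : ℝ}
    (hf : DifferentiableOn ℂ f (ball 0 R)) (hρR : ρ₁ < R) (h01 : ρ₀ < ρ₁)
    (hB : ∀ z : E, ‖z‖ ≤ ρ₁ → ‖f z‖ ≤ B) {p : E} (hp : ‖p‖ ≤ ρ₀) (v : E) :
    ‖fderiv ℂ f p v‖ ≤ B / (ρ₁ - ρ₀) * ‖v‖ := by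
  by_cases hv : v = 0
  · subst hv; simp
  have hvpos : 0 < ‖v‖ := norm_pos_iff.mpr hv
  have hvne : ‖v‖ ≠ 0 := hvpos.ne'
  have hdpos : 0 < ρ₁ - ρ₀ := sub_pos.mpr h01
  set r : ℝ := (ρ₁ - ρ₀) / ‖v‖ with hr_def
  have hr : 0 < r := div_pos hdpos hvpos
  have hrv : r * ‖v‖ = ρ₁ - ρ₀ := div_mul_cancel₀ _ hvne
  have hle : ∀ t : ℂ, ‖t‖ ≤ r → ‖p + t • v‖ ≤ ρ₁ := by
    intro t ht
    calc ‖p + t • v‖ ≤ ‖p‖ + ‖t • v‖ := norm_add_le _ _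
      _ = ‖p‖ + ‖t‖ * ‖v‖ := by rw [norm_smul]
      _ ≤ ρ₀ + r * ‖v‖ := by gcongr
      _ = ρ₁ := by rw [hrv]; ring
  have hmem : ∀ t : ℂ, ‖t‖ ≤ r → p + t • v ∈ ball (0 : E) R := by
    intro t ht
    rw [mem_ball_zero_iff]
    exact (hle t ht).trans_lt hρR
  set g : ℂ → F := fun t => f (p + t • v) with hg
  have hgd : DifferentiableOn ℂ g (closedBall 0 r) := by
    intro t ht
    have ht' : ‖t‖ ≤ r := by simpa using ht
    have h1 : DifferentiableAt ℂ f (p + t • v) :=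
      hf.differentiableAt (isOpen_ball.mem_nhds (hmem t ht'))
    have h2 : DifferentiableAt ℂ (fun s : ℂ => p + s • v) t := by fun_prop
    exact (h1.comp t h2).differentiableWithinAt
  have hdc : DiffContOnCl ℂ g (ball 0 r) := hgd.diffContOnCl_ball subset_rfl
  have hsph : ∀ t ∈ sphere (0 : ℂ) r, ‖g t‖ ≤ B := by
    intro t ht
    have htr : ‖t‖ = r := by simpa using ht
    exact hB _ (hle t htr.le)
  have hderiv : deriv g 0 = fderiv ℂ f p v := by
    have hp0 : p ∈ ball (0 : E) R := by simpa using hmem 0 (by simp [hr.le])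
    exact deriv_line_eq_fderiv (hf.differentiableAt (isOpen_ball.mem_nhds hp0)) v
  have hC := Complex.norm_deriv_le_of_forall_mem_sphere_norm_le hr hdc hsph
  rw [hderiv] at hC
  calc ‖fderiv ℂ f p v‖ ≤ B / r := hC
    _ = B / (ρ₁ - ρ₀) * ‖v‖ := by
        rw [hr_def]
        have hdne : ρ₁ - ρ₀ ≠ 0 := hdpos.ne'
        field_simp

/-- The derivative of an analytic map along a fixed direction is analytic (open domain; no completeness of the
target needed: `AnalyticOnNhd.fderiv_of_isOpen`). [folklore] -/
theorem analyticOnNhd_fderiv_apply {f : E → F} {U : Set E} (hf : AnalyticOnNhd ℂ f U) (hU : IsOpen U) (v : E) :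
    AnalyticOnNhd ℂ (fun z => fderiv ℂ f z v) U := by
  intro z hz
  have h1 : AnalyticAt ℂ (fderiv ℂ f) z := (hf.fderiv_of_isOpen hU) z hz
  have h2 : AnalyticAt ℂ (⇑(ContinuousLinearMap.apply ℂ F v)) (fderiv ℂ f z) :=
    (ContinuousLinearMap.apply ℂ F v).analyticAt _
  refine (h2.comp h1).congr (Eventually.of_forall fun y => ?_)
  simp [Function.comp]

/-- `z ↦ d2 f z u v` is analytic where `f` is (open domain). [folklore] -/
theorem analyticOnNhd_d2 {f : E → F} {U : Set E} (hf : AnalyticOnNhd ℂ f U) (hU : IsOpen U) (u v : E) :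
    AnalyticOnNhd ℂ (fun z => d2 f z u v) U :=
  analyticOnNhd_fderiv_apply (analyticOnNhd_fderiv_apply hf hU v) hU u

/-- **Two nested Cauchy steps.**  `f` analytic on `ball 0 R`, `‖f z‖ ≤ B` for `‖z‖ ≤ ρ₂ < R`, shells
`ρ₀ < ρ₁ < ρ₂`, `‖p‖ ≤ ρ₀` ⇒ `‖∂_u∂_v f(p)‖ ≤ B‖u‖‖v‖/((ρ₂ − ρ₁)(ρ₁ − ρ₀))`. [folklore] -/
theorem norm_d2_le_of_bound {f : E → F} {R ρ₀ ρ₁ ρ₂ B : ℝ}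
    (hf : AnalyticOnNhd ℂ f (ball 0 R)) (hρR : ρ₂ < R) (h01 : ρ₀ < ρ₁) (h12 : ρ₁ < ρ₂)
    (hB : ∀ z : E, ‖z‖ ≤ ρ₂ → ‖f z‖ ≤ B) {p : E} (hp : ‖p‖ ≤ ρ₀) (u v : E) :
    ‖d2 f p u v‖ ≤ B / (ρ₂ - ρ₁) / (ρ₁ - ρ₀) * ‖u‖ * ‖v‖ := by
  have hg : DifferentiableOn ℂ (fun z => fderiv ℂ f z v) (ball 0 R) :=
    (analyticOnNhd_fderiv_apply hf isOpen_ball v).differentiableOn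
  have hgB : ∀ z : E, ‖z‖ ≤ ρ₁ → ‖fderiv ℂ f z v‖ ≤ B / (ρ₂ - ρ₁) * ‖v‖ :=
    fun z hz => norm_fderiv_apply_le_of_bound hf.differentiableOn hρR h12 hB hz v
  have h := norm_fderiv_apply_le_of_bound hg (h12.trans hρR) h01 hgB hp u
  calc ‖d2 f p u v‖ = ‖fderiv ℂ (fun z => fderiv ℂ f z v) p u‖ := rfl
    _ ≤ B / (ρ₂ - ρ₁) * ‖v‖ / (ρ₁ - ρ₀) * ‖u‖ := h
    _ = B / (ρ₂ - ρ₁) / (ρ₁ - ρ₀) * ‖u‖ * ‖v‖ := by ring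

/-- **Three nested Cauchy steps** (Part B): shells `ρ₀ < ρ₁ < ρ₂ < ρ₃ < R`, `‖f‖ ≤ B` on `‖z‖ ≤ ρ₃`, `‖p‖ ≤ ρ₀` ⇒
`‖∂_x∂_u∂_v f(p)‖ ≤ B‖x‖‖u‖‖v‖/((ρ₃ − ρ₂)(ρ₂ − ρ₁)(ρ₁ − ρ₀))`. [folklore] -/
theorem norm_d3_le_of_bound {f : E → F} {R ρ₀ ρ₁ ρ₂ ρ₃ B : ℝ}
    (hf : AnalyticOnNhd ℂ f (ball 0 R)) (hρR : ρ₃ < R) (h01 : ρ₀ < ρ₁) (h12 : ρ₁ < ρ₂) (h23 : ρ₂ < ρ₃)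
    (hB : ∀ z : E, ‖z‖ ≤ ρ₃ → ‖f z‖ ≤ B) {p : E} (hp : ‖p‖ ≤ ρ₀) (x u v : E) :
    ‖d3 f p x u v‖ ≤ B / (ρ₃ - ρ₂) / (ρ₂ - ρ₁) / (ρ₁ - ρ₀) * ‖x‖ * ‖u‖ * ‖v‖ := by
  have hg : DifferentiableOn ℂ (fun z => d2 f z u v) (ball 0 R) :=
    (analyticOnNhd_d2 hf isOpen_ball u v).differentiableOn
  have hgB : ∀ z : E, ‖z‖ ≤ ρ₁ → ‖d2 f z u v‖ ≤ B / (ρ₃ - ρ₂) / (ρ₂ - ρ₁) * ‖u‖ * ‖v‖ :=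
    fun z hz => norm_d2_le_of_bound hf hρR h12 h23 hB hz u v
  have h := norm_fderiv_apply_le_of_bound hg (h12.trans (h23.trans hρR)) h01 hgB hp x
  calc ‖d3 f p x u v‖ = ‖fderiv ℂ (fun z => d2 f z u v) p x‖ := rfl
    _ ≤ B / (ρ₃ - ρ₂) / (ρ₂ - ρ₁) * ‖u‖ * ‖v‖ / (ρ₁ - ρ₀) * ‖x‖ := h
    _ = B / (ρ₃ - ρ₂) / (ρ₂ - ρ₁) / (ρ₁ - ρ₀) * ‖x‖ * ‖u‖ * ‖v‖ := by ring

/-! ## The cubic bound (the shape of (1.39)) -/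

omit [NormedSpace ℂ E] [NormedSpace ℂ F] in
/-- A cubic bound on the ball gives the sup bound `K ρ³` on `‖z‖ ≤ ρ < R`. [folklore] -/
theorem bound_of_cubic {f : E → F} {R K ρ : ℝ} (hK0 : 0 ≤ K)
    (hK : ∀ z ∈ ball (0 : E) R, ‖f z‖ ≤ K * ‖z‖ ^ 3) (hρR : ρ < R) :
    ∀ z : E, ‖z‖ ≤ ρ → ‖f z‖ ≤ K * ρ ^ 3 := by
  intro z hz
  have hzR : z ∈ ball (0 : E) R := by
    rw [mem_ball_zero_iff]; exact hz.trans_lt hρR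
  calc ‖f z‖ ≤ K * ‖z‖ ^ 3 := hK z hzR
    _ ≤ K * ρ ^ 3 := by gcongr

omit [NormedSpace ℂ E] [NormedSpace ℂ F] in
/-- A cubic bound forces `f 0 = 0` (the printed "terms of zeroth … order vanish"). [folklore] -/
theorem eq_zero_of_cubic {f : E → F} {R K : ℝ} (hR : 0 < R)
    (hK : ∀ z ∈ ball (0 : E) R, ‖f z‖ ≤ K * ‖z‖ ^ 3) : f 0 = 0 := by
  have h := hK 0 (mem_ball_self hR)
  simpa using h

/-- A cubic bound forces `Df(0) = 0` (the printed "terms of … first order vanish"): ‖Df(0)v‖ ≤ K s³‖v‖/s = Ks²‖v‖ for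
every small `s > 0`. [folklore] -/
theorem fderiv_zero_apply_eq_zero_of_cubic {f : E → F} {R K : ℝ} (hK0 : 0 ≤ K) (hR : 0 < R)
    (hf : DifferentiableOn ℂ f (ball 0 R))
    (hK : ∀ z ∈ ball (0 : E) R, ‖f z‖ ≤ K * ‖z‖ ^ 3) (v : E) : fderiv ℂ f 0 v = 0 := by
  have key : ∀ s ∈ Ioo 0 R, ‖fderiv ℂ f (0 : E) v‖ ≤ K * s ^ 2 * ‖v‖ := by
    intro s hs
    have hB := bound_of_cubic hK0 hK hs.2
    have h := norm_fderiv_apply_le_of_bound hf hs.2 hs.1 hB (le_of_eq norm_zero) v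
    calc ‖fderiv ℂ f (0 : E) v‖ ≤ K * s ^ 3 / (s - 0) * ‖v‖ := h
      _ = K * s ^ 2 * ‖v‖ := by
          have : s ≠ 0 := hs.1.ne'
          rw [sub_zero]
          field_simp
  have hcont : Tendsto (fun s : ℝ => K * s ^ 2 * ‖v‖) (𝓝[>] 0) (𝓝 (K * 0 ^ 2 * ‖v‖)) := by
    have : ContinuousAt (fun s : ℝ => K * s ^ 2 * ‖v‖) 0 := by fun_prop
    exact this.tendsto.mono_left nhdsWithin_le_nhds
  have hev : ∀ᶠ s in 𝓝[>] (0 : ℝ), ‖fderiv ℂ f (0 : E) v‖ ≤ K * s ^ 2 * ‖v‖ := by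
    filter_upwards [Ioo_mem_nhdsGT hR] with s hs using key s hs
  have h := ge_of_tendsto hcont hev
  have h0 : ‖fderiv ℂ f (0 : E) v‖ ≤ 0 := by simpa using h
  exact norm_le_zero_iff.mp h0

/-- Second derivative under the cubic bound, explicit shells: `‖p‖ ≤ β`, `0 < s`, `β + 2s < R` ⇒
`‖∂_u∂_v f(p)‖ ≤ K(β + 2s)³‖u‖‖v‖/s²`. [folklore] -/
theorem norm_d2_le_of_cubic_aux {f : E → F} {R K β s : ℝ} (hK0 : 0 ≤ K)
    (hf : AnalyticOnNhd ℂ f (ball 0 R))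
    (hK : ∀ z ∈ ball (0 : E) R, ‖f z‖ ≤ K * ‖z‖ ^ 3)
    (hs : 0 < s) (hR : β + 2 * s < R) {p : E} (hp : ‖p‖ ≤ β) (u v : E) :
    ‖d2 f p u v‖ ≤ K * (β + 2 * s) ^ 3 / s ^ 2 * ‖u‖ * ‖v‖ := by
  have hB := bound_of_cubic hK0 hK hR
  have h := norm_d2_le_of_bound hf hR (by linarith : β < β + s) (by linarith : β + s < β + 2 * s) hB hp u v
  have e1 : β + 2 * s - (β + s) = s := by ring
  have e2 : β + s - β = s := by ring
  rw [e1, e2] at h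
  calc ‖d2 f p u v‖ ≤ K * (β + 2 * s) ^ 3 / s / s * ‖u‖ * ‖v‖ := h
    _ = K * (β + 2 * s) ^ 3 / s ^ 2 * ‖u‖ * ‖v‖ := by ring

/-- **27Kβ** (positive radius).  Cubic bound on `ball 0 R`, `f` analytic there, `0 < β`, `3β ≤ R`, `‖p‖ ≤ β` ⇒
`‖∂_u∂_v f(p)‖ ≤ 27Kβ‖u‖‖v‖` — shells β < β + s < β + 2s with s ↑ β (the closed third-ball is reached in the
limit, so only the OPEN ball of radius R = 3β is ever used). [folklore] -/
theorem norm_d2_le_of_cubic_pos {f : E → F} {R K β : ℝ} (hK0 : 0 ≤ K)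
    (hf : AnalyticOnNhd ℂ f (ball 0 R))
    (hK : ∀ z ∈ ball (0 : E) R, ‖f z‖ ≤ K * ‖z‖ ^ 3)
    (hβ : 0 < β) (h3 : 3 * β ≤ R) {p : E} (hp : ‖p‖ ≤ β) (u v : E) :
    ‖d2 f p u v‖ ≤ 27 * K * β * ‖u‖ * ‖v‖ := by
  have key : ∀ s ∈ Ioo 0 β, ‖d2 f p u v‖ ≤ K * (β + 2 * s) ^ 3 / s ^ 2 * ‖u‖ * ‖v‖ :=
    fun s hs => norm_d2_le_of_cubic_aux hK0 hf hK hs.1 (by linarith [hs.2]) hp u v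
  have hcont : Tendsto (fun s : ℝ => K * (β + 2 * s) ^ 3 / s ^ 2 * ‖u‖ * ‖v‖) (𝓝[<] β)
      (𝓝 (K * (β + 2 * β) ^ 3 / β ^ 2 * ‖u‖ * ‖v‖)) := by
    have hβ2 : β ^ 2 ≠ 0 := by positivity
    have : ContinuousAt (fun s : ℝ => K * (β + 2 * s) ^ 3 / s ^ 2 * ‖u‖ * ‖v‖) β := by
      fun_prop (disch := exact hβ2)
    exact this.tendsto.mono_left nhdsWithin_le_nhds
  have hev : ∀ᶠ s in 𝓝[<] β, ‖d2 f p u v‖ ≤ K * (β + 2 * s) ^ 3 / s ^ 2 * ‖u‖ * ‖v‖ := by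
    filter_upwards [Ioo_mem_nhdsLT hβ] with s hs using key s hs
  have h := ge_of_tendsto hcont hev
  calc ‖d2 f p u v‖ ≤ K * (β + 2 * β) ^ 3 / β ^ 2 * ‖u‖ * ‖v‖ := h
    _ = 27 * K * β * ‖u‖ * ‖v‖ := by
        have hβ' : β ≠ 0 := hβ.ne'
        field_simp
        ring

/-- **27Kβ.**  As `norm_d2_le_of_cubic_pos`, for `0 ≤ β` (at `β = 0`, i.e. `p = 0`, the second derivative vanishes:
cubic vanishing). [folklore] -/
theorem norm_d2_le_of_cubic {f : E → F} {R K β : ℝ} (hK0 : 0 ≤ K)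
    (hf : AnalyticOnNhd ℂ f (ball 0 R))
    (hK : ∀ z ∈ ball (0 : E) R, ‖f z‖ ≤ K * ‖z‖ ^ 3)
    (hRpos : 0 < R) (hβ : 0 ≤ β) (h3 : 3 * β ≤ R) {p : E} (hp : ‖p‖ ≤ β) (u v : E) :
    ‖d2 f p u v‖ ≤ 27 * K * β * ‖u‖ * ‖v‖ := by
  rcases hβ.eq_or_lt with hβ0 | hβpos
  · -- β = 0: `‖p‖ ≤ β'` for every `β' ∈ (0, R/3)`, and 27Kβ'‖u‖‖v‖ → 0
    subst hβ0
    have key : ∀ β' ∈ Ioo 0 (R / 3), ‖d2 f p u v‖ ≤ 27 * K * β' * ‖u‖ * ‖v‖ :=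
      fun β' hβ' => norm_d2_le_of_cubic_pos hK0 hf hK hβ'.1 (by linarith [hβ'.2]) (hp.trans hβ'.1.le) u v
    have hcont : Tendsto (fun β' : ℝ => 27 * K * β' * ‖u‖ * ‖v‖) (𝓝[>] 0)
        (𝓝 (27 * K * 0 * ‖u‖ * ‖v‖)) := by
      have : ContinuousAt (fun β' : ℝ => 27 * K * β' * ‖u‖ * ‖v‖) 0 := by fun_prop
      exact this.tendsto.mono_left nhdsWithin_le_nhds
    have hev : ∀ᶠ β' in 𝓝[>] (0 : ℝ), ‖d2 f p u v‖ ≤ 27 * K * β' * ‖u‖ * ‖v‖ := by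
      filter_upwards [Ioo_mem_nhdsGT (by linarith : (0 : ℝ) < R / 3)] with s hs using key s hs
    exact ge_of_tendsto hcont hev
  · exact norm_d2_le_of_cubic_pos hK0 hf hK hβpos h3 hp u v

/-! ## The printed coefficient `∫₀¹ dt (1 − t) ∂²(1.38)(tB′)` -/

/-- The printed coefficient of (1.40): `∫₀¹ dt (1 − t) ∂_u∂_v Fk(tB′)` — the second derivative OF the function (1.38)
evaluated AT `tB′`, weighted by `(1 − t)dt` (integral-remainder coefficient of Taylor's formula at order 2).
[cite: Balaban1988RG2Cluster, (1.40) p.10] -/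
def coeff140 (f : E → F) (B' u v : E) : F :=
  ∫ t in (0 : ℝ)..1, (1 - t) • d2 f ((t : ℂ) • B') u v

/-- `∫₀¹ (1 − t)·c dt = c/2`. [folklore] -/
theorem integral_one_sub_mul (c : ℝ) : ∫ t in (0 : ℝ)..1, (1 - t) * c = 1 / 2 * c := by
  have hF : ∀ t ∈ Set.uIcc (0 : ℝ) 1, HasDerivAt (fun t : ℝ => (t - t ^ 2 / 2) * c) ((1 - t) * c) t := by
    intro t _
    have h1 : HasDerivAt (fun t : ℝ => t - t ^ 2 / 2) (1 - t) t := by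
      refine ((hasDerivAt_id' t).sub ((hasDerivAt_pow 2 t).div_const 2)).congr_deriv ?_
      norm_num
    exact h1.mul_const c
  have hint : IntervalIntegrable (fun t : ℝ => (1 - t) * c) MeasureTheory.volume 0 1 := by
    apply Continuous.intervalIntegrable; fun_prop
  rw [intervalIntegral.integral_eq_sub_of_hasDerivAt hF hint]
  ring

/-- **The analytic core of (1.39) ⇒ (1.40).**  `f` analytic on `ball 0 R` with `‖f z‖ ≤ K‖z‖³` there (`K ≥ 0`,
`R > 0`); then for `3‖B′‖ ≤ R` and directions `‖u‖, ‖v‖ ≤ 1`: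
`‖∫₀¹ (1 − t) ∂_u∂_v f(tB′) dt‖ ≤ ½·27·K·‖B′‖` (pointwise `‖∂_u∂_v f(tB′)‖ ≤ 27K‖B′‖` for `t ∈ [0,1]`, and
`∫₀¹(1 − t)dt = ½`). [folklore] -/
theorem norm_coeff140_le {f : E → F} {R K : ℝ} (hK0 : 0 ≤ K)
    (hf : AnalyticOnNhd ℂ f (ball 0 R))
    (hK : ∀ z ∈ ball (0 : E) R, ‖f z‖ ≤ K * ‖z‖ ^ 3)
    (hRpos : 0 < R) {B' : E} (hB' : 3 * ‖B'‖ ≤ R) {u v : E} (hu : ‖u‖ ≤ 1) (hv : ‖v‖ ≤ 1) :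
    ‖coeff140 f B' u v‖ ≤ 1 / 2 * (27 * K * ‖B'‖) := by
  have hpt : ∀ t : ℝ, t ∈ Set.Ioc (0 : ℝ) 1 →
      ‖(1 - t) • d2 f ((t : ℂ) • B') u v‖ ≤ (1 - t) * (27 * K * ‖B'‖) := by
    intro t ht
    have ht0 : 0 ≤ t := ht.1.le
    have ht1 : t ≤ 1 := ht.2
    have hp : ‖(t : ℂ) • B'‖ ≤ ‖B'‖ := by
      rw [norm_smul, Complex.norm_real, Real.norm_of_nonneg ht0]
      calc t * ‖B'‖ ≤ 1 * ‖B'‖ := by gcongr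
        _ = ‖B'‖ := one_mul _
    have h := norm_d2_le_of_cubic hK0 hf hK hRpos (norm_nonneg B') hB' hp u v
    have h27 : 27 * K * ‖B'‖ * ‖u‖ * ‖v‖ ≤ 27 * K * ‖B'‖ := by
      have h1 : 27 * K * ‖B'‖ * ‖u‖ * ‖v‖ ≤ 27 * K * ‖B'‖ * 1 * 1 := by gcongr
      simpa using h1
    rw [norm_smul, Real.norm_of_nonneg (by linarith)]
    exact mul_le_mul_of_nonneg_left (h.trans h27) (by linarith)
  have hint : IntervalIntegrable (fun t : ℝ => (1 - t) * (27 * K * ‖B'‖)) MeasureTheory.volume 0 1 := by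
    apply Continuous.intervalIntegrable; fun_prop
  have h1 := intervalIntegral.norm_integral_le_of_norm_le zero_le_one (Eventually.of_forall hpt) hint
  calc ‖coeff140 f B' u v‖ ≤ ∫ t in (0 : ℝ)..1, (1 - t) * (27 * K * ‖B'‖) := h1
    _ = 1 / 2 * (27 * K * ‖B'‖) := integral_one_sub_mul _

end General

/-! ## (1.39) ⇒ (1.40) with the printed constants -/

section Printed

variable {E F : Type*} [NormedAddCommGroup E] [NormedSpace ℂ E]
  [NormedAddCommGroup F] [NormedSpace ℂ F]

/-- The radius of the analyticity polydisc of p. 10, *"{B′ : e^{16κ₁}|B′| ≦ a₁ on Y}"*: `e^{16κ₁}‖B′‖ ≤ a₁` iff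
`‖B′‖ ≤ a₁e^{−16κ₁} = rad κ₁ a₁`. [cite: Balaban1988RG2Cluster, p.10] -/
def rad (κ₁ a₁ : ℝ) : ℝ := a₁ * Real.exp (-(16 * κ₁))

/-- The radius is positive for `a₁ > 0`. [folklore] -/
theorem rad_pos {κ₁ a₁ : ℝ} (ha₁ : 0 < a₁) : 0 < rad κ₁ a₁ := mul_pos ha₁ (Real.exp_pos _)

omit [NormedSpace ℂ E] in
/-- `e^{16κ₁}‖B′‖ ≤ a₁/3` ⇒ `3‖B′‖ ≤ rad κ₁ a₁`. [folklore] -/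
theorem three_norm_le_rad {κ₁ a₁ : ℝ} {B' : E} (hB' : Real.exp (16 * κ₁) * ‖B'‖ ≤ a₁ / 3) :
    3 * ‖B'‖ ≤ rad κ₁ a₁ := by
  unfold rad
  have he : Real.exp (-(16 * κ₁)) * Real.exp (16 * κ₁) = 1 := by
    rw [← Real.exp_add]; simp
  have hpos : 0 < Real.exp (-(16 * κ₁)) := Real.exp_pos _
  calc 3 * ‖B'‖ = 3 * (Real.exp (-(16 * κ₁)) * (Real.exp (16 * κ₁) * ‖B'‖)) := by
        rw [← mul_assoc (Real.exp _), he, one_mul]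
    _ ≤ 3 * (Real.exp (-(16 * κ₁)) * (a₁ / 3)) := by gcongr
    _ = a₁ * Real.exp (-(16 * κ₁)) := by ring

omit [NormedSpace ℂ E] in
/-- A fraction `c` of the radius: `e^{16κ₁}‖B′‖ ≤ a₁/c` ⇒ `c‖B′‖ ≤ rad κ₁ a₁` (`c > 0`). [folklore] -/
theorem mul_norm_le_rad {κ₁ a₁ c : ℝ} (hc : 0 < c) {B' : E} (hB' : Real.exp (16 * κ₁) * ‖B'‖ ≤ a₁ / c) :
    c * ‖B'‖ ≤ rad κ₁ a₁ := by
  unfold rad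
  have he : Real.exp (-(16 * κ₁)) * Real.exp (16 * κ₁) = 1 := by
    rw [← Real.exp_add]; simp
  have hpos : 0 < Real.exp (-(16 * κ₁)) := Real.exp_pos _
  calc c * ‖B'‖ = c * (Real.exp (-(16 * κ₁)) * (Real.exp (16 * κ₁) * ‖B'‖)) := by
        rw [← mul_assoc (Real.exp _), he, one_mul]
    _ ≤ c * (Real.exp (-(16 * κ₁)) * (a₁ / c)) := by gcongr
    _ = a₁ * Real.exp (-(16 * κ₁)) := by field_simp

/-- **(1.39)**, p. 10, typed as a property of the term (1.38) `Fk` (for a fixed localization domain `Y ∋ □` and fixed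
(U, J)): *"|(1.38)| ≦ C₃(e^{16κ₁}|B′|)³M⁴exp(−(κ₁ − 1)M⁻⁴|Y∖□|), (1.39) where C₃ is an absolute constant"* — on the
(open) analyticity polydisc `‖B′‖ < rad κ₁ a₁`; `nYc` stands for the number M⁻⁴|Y∖□|.
[cite: Balaban1988RG2Cluster, (1.39) p.10] -/
def Ineq139 (Fk : E → F) (κ₁ a₁ C₃ M nYc : ℝ) : Prop :=
  ∀ B' ∈ ball (0 : E) (rad κ₁ a₁),
    ‖Fk B'‖ ≤ C₃ * (Real.exp (16 * κ₁) * ‖B'‖) ^ 3 * M ^ 4 * Real.exp (-(κ₁ - 1) * nYc)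

/-- **(1.40)**, p. 10, typed verbatim as a property of the term (1.38) `Fk`: *"The coefficients satisfy the bound
|∫₀¹ dt(1 − t) ∂²/(∂B′_μ(x)∂B′_ν(y)) ((1.38) with B′ replaced by tB′)| ≦ ½C₃3³e^{7·8κ₁}|B′| exp(−⅛(κ₁ − 1)d_k(Y) −
½(κ₁ − 1)M⁻⁴|Y|), (1.40) if e^{16κ₁}|B′| ≦ ⅓a₁."* — for all `B′` with `e^{16κ₁}‖B′‖ ≤ a₁/3` and all coordinate
(norm ≤ 1) directions `u, v`; `dY` stands for d_k(Y) and `nY` for M⁻⁴|Y|. [cite: Balaban1988RG2Cluster, (1.40) p.10] -/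
def Ineq140Printed (Fk : E → F) (κ₁ a₁ C₃ dY nY : ℝ) : Prop :=
  ∀ B' : E, Real.exp (16 * κ₁) * ‖B'‖ ≤ a₁ / 3 → ∀ u v : E, ‖u‖ ≤ 1 → ‖v‖ ≤ 1 →
    ‖coeff140 Fk B' u v‖ ≤ 1 / 2 * C₃ * 3 ^ 3 * Real.exp (7 * 8 * κ₁) * ‖B'‖ *
      Real.exp (-(1 / 8) * (κ₁ - 1) * dY - 1 / 2 * (κ₁ - 1) * nY)

/-- `(e^{16κ₁})³ = e^{48κ₁}`. [folklore] -/
theorem exp16_pow_three (κ₁ : ℝ) : Real.exp (16 * κ₁) ^ 3 = Real.exp (48 * κ₁) := by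
  rw [← Real.exp_nat_mul]; congr 1; push_cast; ring

omit [NormedSpace ℂ E] [NormedSpace ℂ F] in
/-- (1.39) as a cubic bound `‖Fk z‖ ≤ K‖z‖³` with `K = C₃e^{48κ₁}·M⁴exp(−(κ₁ − 1)nYc)`. [folklore] -/
theorem cubic_of_139 {Fk : E → F} {κ₁ a₁ C₃ M nYc : ℝ} (h139 : Ineq139 Fk κ₁ a₁ C₃ M nYc) :
    ∀ z ∈ ball (0 : E) (rad κ₁ a₁),
      ‖Fk z‖ ≤ C₃ * Real.exp (48 * κ₁) * (M ^ 4 * Real.exp (-(κ₁ - 1) * nYc)) * ‖z‖ ^ 3 := by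
  intro z hz
  calc ‖Fk z‖ ≤ C₃ * (Real.exp (16 * κ₁) * ‖z‖) ^ 3 * M ^ 4 * Real.exp (-(κ₁ - 1) * nYc) := h139 z hz
    _ = C₃ * Real.exp (48 * κ₁) * (M ^ 4 * Real.exp (-(κ₁ - 1) * nYc)) * ‖z‖ ^ 3 := by
        rw [mul_pow, exp16_pow_three]; ring

/-- **(1.40), sharp form — the kernel content.**  Analyticity of (1.38) on the polydisc and (1.39) (`C₃ ≥ 0`, `a₁ > 0`)
give, for `e^{16κ₁}‖B′‖ ≤ a₁/3` and coordinate directions `‖u‖, ‖v‖ ≤ 1`: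
`‖∫₀¹(1 − t)∂_u∂_v(1.38)(tB′)dt‖ ≤ ½C₃3³e^{48κ₁}·M⁴exp(−(κ₁ − 1)M⁻⁴|Y∖□|)·‖B′‖` — the printed ½·3³ exactly, with
e^{3·16κ₁} and the factor M⁴exp(−(κ₁ − 1)M⁻⁴|Y∖□|) of (1.39) still explicit (no restriction on M, κ₁ used).
[cite: Balaban1988RG2Cluster, (1.39)–(1.40) p.10] -/
theorem ineq140_sharp {Fk : E → F} {κ₁ a₁ C₃ M nYc : ℝ} (ha₁ : 0 < a₁) (hC₃ : 0 ≤ C₃)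
    (hF : AnalyticOnNhd ℂ Fk (ball 0 (rad κ₁ a₁))) (h139 : Ineq139 Fk κ₁ a₁ C₃ M nYc)
    {B' : E} (hB' : Real.exp (16 * κ₁) * ‖B'‖ ≤ a₁ / 3) {u v : E} (hu : ‖u‖ ≤ 1) (hv : ‖v‖ ≤ 1) :
    ‖coeff140 Fk B' u v‖ ≤
      1 / 2 * C₃ * 3 ^ 3 * Real.exp (48 * κ₁) * (M ^ 4 * Real.exp (-(κ₁ - 1) * nYc)) * ‖B'‖ := by
  set K : ℝ := C₃ * Real.exp (48 * κ₁) * (M ^ 4 * Real.exp (-(κ₁ - 1) * nYc)) with hK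
  have hM4 : 0 ≤ M ^ 4 := by positivity
  have hK0 : 0 ≤ K := by positivity
  have hcubic := cubic_of_139 h139
  have h := norm_coeff140_le hK0 hF hcubic (rad_pos ha₁) (three_norm_le_rad hB') hu hv
  calc ‖coeff140 Fk B' u v‖ ≤ 1 / 2 * (27 * K * ‖B'‖) := h
    _ = 1 / 2 * C₃ * 3 ^ 3 * Real.exp (48 * κ₁) * (M ^ 4 * Real.exp (-(κ₁ - 1) * nYc)) * ‖B'‖ := by
        rw [hK]; norm_num; ring

/-- The printed (2.30) upper half `d_k(Y) ≦ M⁻⁴|Y| − 1` (p. 18; kernel: `TreeLength.treeLen_le_card_sub_one`) gives the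
form `d_k(Y) ≤ 4·M⁻⁴|Y|` used below (M⁻⁴|Y| ≥ 0). [cite: Balaban1988RG2Cluster, (2.30) p.18] -/
theorem four_n_of_230 {dY nY : ℝ} (h230 : dY ≤ nY - 1) (hn : 0 ≤ nY) : dY ≤ 4 * nY := by linarith

/-- **The exponent bookkeeping of (1.40)** (pure arithmetic).  With M⁻⁴|Y∖□| = M⁻⁴|Y| − 1 (= `nY − 1`):
`e^{48κ₁}·M⁴e^{−(κ₁−1)(nY−1)} ≤ e^{7·8κ₁}·e^{−⅛(κ₁−1)dY − ½(κ₁−1)nY}` provided κ₁ ≥ 1, `dY ≤ 4nY` ((2.30)) and the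
ABSORPTION HYPOTHESIS (R10 of cell GAPS C-B13-01) `M⁴e^{κ₁−1} ≤ e^{8κ₁}`, i.e. 4 ln M ≤ 7κ₁ + 1 — implicit in print,
explicit here. [cite: Balaban1988RG2Cluster, (1.40) p.10] -/
theorem absorb140 {κ₁ M dY nY : ℝ} (hκ : 1 ≤ κ₁) (hd : dY ≤ 4 * nY)
    (hR10 : M ^ 4 * Real.exp (κ₁ - 1) ≤ Real.exp (8 * κ₁)) :
    Real.exp (48 * κ₁) * (M ^ 4 * Real.exp (-(κ₁ - 1) * (nY - 1))) ≤
      Real.exp (7 * 8 * κ₁) * Real.exp (-(1 / 8) * (κ₁ - 1) * dY - 1 / 2 * (κ₁ - 1) * nY) := by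
  have h1 : Real.exp (-(κ₁ - 1) * (nY - 1)) = Real.exp (κ₁ - 1) * Real.exp (-(κ₁ - 1) * nY) := by
    rw [← Real.exp_add]; congr 1; ring
  have h2 : Real.exp (-(κ₁ - 1) * nY) ≤ Real.exp (-(1 / 8) * (κ₁ - 1) * dY - 1 / 2 * (κ₁ - 1) * nY) := by
    apply Real.exp_le_exp.mpr
    have hk : 0 ≤ κ₁ - 1 := by linarith
    have h3 : (κ₁ - 1) * dY ≤ (κ₁ - 1) * (4 * nY) := mul_le_mul_of_nonneg_left hd hk
    linarith
  have h4 : Real.exp (48 * κ₁) * Real.exp (8 * κ₁) = Real.exp (7 * 8 * κ₁) := by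
    rw [← Real.exp_add]; congr 1; ring
  calc Real.exp (48 * κ₁) * (M ^ 4 * Real.exp (-(κ₁ - 1) * (nY - 1)))
        = Real.exp (48 * κ₁) * ((M ^ 4 * Real.exp (κ₁ - 1)) * Real.exp (-(κ₁ - 1) * nY)) := by
          rw [h1]; ring
    _ ≤ Real.exp (48 * κ₁) *
          (Real.exp (8 * κ₁) * Real.exp (-(1 / 8) * (κ₁ - 1) * dY - 1 / 2 * (κ₁ - 1) * nY)) := by
          gcongr
    _ = Real.exp (7 * 8 * κ₁) * Real.exp (-(1 / 8) * (κ₁ - 1) * dY - 1 / 2 * (κ₁ - 1) * nY) := by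
          rw [← mul_assoc, h4]

/-- **(1.39) ⇒ (1.40) as printed.**  Hypotheses: the analyticity of (1.38) in B′ on the polydisc and (1.39) with
M⁻⁴|Y∖□| = M⁻⁴|Y| − 1 (the admissible cube □ ⊂ Y is one of the M⁻⁴|Y| cubes of Y), `a₁ > 0`, `C₃ ≥ 0`, `κ₁ ≥ 1`,
`d_k(Y) ≤ 4·M⁻⁴|Y|` (⇐ (2.30)), and the absorption hypothesis R10 `M⁴e^{κ₁−1} ≤ e^{8κ₁}`.  Conclusion: (1.40)
verbatim (`Ineq140Printed`). [cite: Balaban1988RG2Cluster, (1.39)–(1.40) p.10] -/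
theorem ineq140Printed_of_139 {Fk : E → F} {κ₁ a₁ C₃ M dY nY : ℝ} (ha₁ : 0 < a₁) (hC₃ : 0 ≤ C₃)
    (hκ : 1 ≤ κ₁) (hd : dY ≤ 4 * nY) (hR10 : M ^ 4 * Real.exp (κ₁ - 1) ≤ Real.exp (8 * κ₁))
    (hF : AnalyticOnNhd ℂ Fk (ball 0 (rad κ₁ a₁))) (h139 : Ineq139 Fk κ₁ a₁ C₃ M (nY - 1)) :
    Ineq140Printed Fk κ₁ a₁ C₃ dY nY := by
  intro B' hB' u v hu hv
  have h := ineq140_sharp ha₁ hC₃ hF h139 hB' hu hv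
  have ha := absorb140 hκ hd hR10
  have hc : 0 ≤ 1 / 2 * C₃ * 3 ^ 3 * ‖B'‖ := by positivity
  calc ‖coeff140 Fk B' u v‖
        ≤ 1 / 2 * C₃ * 3 ^ 3 * Real.exp (48 * κ₁) * (M ^ 4 * Real.exp (-(κ₁ - 1) * (nY - 1))) * ‖B'‖ := h
    _ = 1 / 2 * C₃ * 3 ^ 3 * ‖B'‖ * (Real.exp (48 * κ₁) * (M ^ 4 * Real.exp (-(κ₁ - 1) * (nY - 1)))) := by
          ring
    _ ≤ 1 / 2 * C₃ * 3 ^ 3 * ‖B'‖ *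
          (Real.exp (7 * 8 * κ₁) * Real.exp (-(1 / 8) * (κ₁ - 1) * dY - 1 / 2 * (κ₁ - 1) * nY)) :=
          mul_le_mul_of_nonneg_left ha hc
    _ = 1 / 2 * C₃ * 3 ^ 3 * Real.exp (7 * 8 * κ₁) * ‖B'‖ *
          Real.exp (-(1 / 8) * (κ₁ - 1) * dY - 1 / 2 * (κ₁ - 1) * nY) := by ring

/-- p. 10 l.-1 – p. 11 l.1: *"Taking B′ as in (1.19) we obtain the above bound with |B′| replaced by C₁ε₁"* — for
`‖B′‖ ≤ C₁ε₁` (and the proviso of (1.40)) the right side of (1.40) with `C₁ε₁` in place of `|B′|`.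
[cite: Balaban1988RG2Cluster, p.10–11] -/
theorem ineq140_C₁ε₁ {Fk : E → F} {κ₁ a₁ C₃ dY nY C₁ ε₁ : ℝ} (hC₃ : 0 ≤ C₃)
    (h140 : Ineq140Printed Fk κ₁ a₁ C₃ dY nY)
    {B' : E} (hB' : Real.exp (16 * κ₁) * ‖B'‖ ≤ a₁ / 3) (hB'C : ‖B'‖ ≤ C₁ * ε₁)
    {u v : E} (hu : ‖u‖ ≤ 1) (hv : ‖v‖ ≤ 1) :
    ‖coeff140 Fk B' u v‖ ≤ 1 / 2 * C₃ * 3 ^ 3 * Real.exp (7 * 8 * κ₁) * (C₁ * ε₁) *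
      Real.exp (-(1 / 8) * (κ₁ - 1) * dY - 1 / 2 * (κ₁ - 1) * nY) := by
  have h := h140 B' hB' u v hu hv
  have hc : 0 ≤ 1 / 2 * C₃ * 3 ^ 3 * Real.exp (7 * 8 * κ₁) := by positivity
  have he : 0 ≤ Real.exp (-(1 / 8) * (κ₁ - 1) * dY - 1 / 2 * (κ₁ - 1) * nY) := (Real.exp_pos _).le
  calc ‖coeff140 Fk B' u v‖ ≤ _ := h
    _ ≤ 1 / 2 * C₃ * 3 ^ 3 * Real.exp (7 * 8 * κ₁) * (C₁ * ε₁) *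
          Real.exp (-(1 / 8) * (κ₁ - 1) * dY - 1 / 2 * (κ₁ - 1) * nY) := by
        gcongr

omit [NormedSpace ℂ F] in
/-- p. 11 l.1–4: *"we sum over all admissible □ ⊂ Y. This yields an expression satisfying the bounds (1.39), (1.40)
with the additional factor M⁻⁴|Y| ≦ exp M⁻⁴|Y|"* — a sum of at most `#cubes` terms each bounded by `b ≥ 0` is
bounded by `#cubes · b ≤ exp(#cubes) · b`. [cite: Balaban1988RG2Cluster, p.11] -/
theorem norm_sum_le_exp_card_mul {ι : Type*} (s : Finset ι) (T : ι → F) {b : ℝ} (hb : 0 ≤ b)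
    (hT : ∀ i ∈ s, ‖T i‖ ≤ b) :
    ‖∑ i ∈ s, T i‖ ≤ Real.exp (s.card : ℝ) * b := by
  have h1 : ‖∑ i ∈ s, T i‖ ≤ (s.card : ℝ) * b := by
    calc ‖∑ i ∈ s, T i‖ ≤ ∑ i ∈ s, ‖T i‖ := norm_sum_le _ _
      _ ≤ ∑ i ∈ s, b := Finset.sum_le_sum hT
      _ = (s.card : ℝ) * b := by simp
  have h2 : (s.card : ℝ) ≤ Real.exp (s.card : ℝ) := by
    have := Real.add_one_le_exp (s.card : ℝ)
    linarith
  exact h1.trans (mul_le_mul_of_nonneg_right h2 hb)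

end Printed

/-! ## Part B — the g-derivative of the cancelled term (AN4 §4 (P1)(i)) -/

section Euler

variable {E F : Type*} [NormedAddCommGroup E] [NormedSpace ℂ E]
  [NormedAddCommGroup F] [NormedSpace ℂ F]

/-- The Euler-type operator of AN4 (P1): `((w∂_w − 2)V)(w) = DV(w)w − 2V(w)` (it kills the quadratic part of `V` and
multiplies the degree-n part by n − 2). [folklore] -/
def euler2 (V : E → F) (w : E) : F := fderiv ℂ V w w - (2 : ℂ) • V w

/-- **AN4 (P1), the identity** `∂_g[(1/g²)V(gY)] = (1/g³)[(w∂_w − 2)V](w)|_{w = gY}` for `g ≠ 0` (complex `g`; the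
printed coupling `g_k ∈ (0, γ]` is the real restriction), `V` differentiable at `gY`. [folklore] -/
theorem hasDerivAt_inv_sq_smul {V : E → F} {Y : E} {g : ℂ} (hg : g ≠ 0)
    (hV : DifferentiableAt ℂ V (g • Y)) :
    HasDerivAt (fun g : ℂ => (g ^ 2)⁻¹ • V (g • Y)) ((g ^ 3)⁻¹ • euler2 V (g • Y)) g := by
  have h1 : HasDerivAt (fun g : ℂ => V (g • Y)) (fderiv ℂ V (g • Y) Y) g := by
    have hl : HasDerivAt (fun g : ℂ => g • Y) Y g := by
      simpa using (hasDerivAt_id g).smul_const Y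
    exact hV.hasFDerivAt.comp_hasDerivAt g hl
  have h2 : HasDerivAt (fun g : ℂ => (g ^ 2)⁻¹) (-((2 : ℕ) * g ^ (2 - 1)) / (g ^ 2) ^ 2) g :=
    (hasDerivAt_pow 2 g).inv (pow_ne_zero 2 hg)
  have h := h2.smul h1
  have hg2 : g ^ 2 ≠ 0 := pow_ne_zero 2 hg
  have hg3 : g ^ 3 ≠ 0 := pow_ne_zero 3 hg
  have hval : (g ^ 3)⁻¹ • euler2 V (g • Y) =
      (g ^ 2)⁻¹ • fderiv ℂ V (g • Y) Y + (-((2 : ℕ) * g ^ (2 - 1)) / (g ^ 2) ^ 2) • V (g • Y) := by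
    unfold euler2
    rw [ContinuousLinearMap.map_smul, smul_sub, smul_smul, smul_smul, sub_eq_add_neg, ← neg_smul]
    congr 1
    · congr 1
      field_simp
    · congr 1
      push_cast
      field_simp
  rw [hval]
  exact h

/-- **Cubic bound for (w∂_w − 2)V** with an ABSOLUTE factor: `V` complex-differentiable on `ball 0 R` with
`‖V z‖ ≤ K‖z‖³` there ⇒ `‖((w∂_w − 2)V)(w)‖ ≤ (35/4)K‖w‖³` whenever `(3/2)‖w‖ < R` (one Cauchy step at shells
‖w‖ < 3‖w‖/2 for `DV(w)w`, plus 2K‖w‖³). [folklore] -/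
theorem norm_euler2_le {V : E → F} {R K : ℝ} (hK0 : 0 ≤ K)
    (hV : DifferentiableOn ℂ V (ball 0 R))
    (hK : ∀ z ∈ ball (0 : E) R, ‖V z‖ ≤ K * ‖z‖ ^ 3)
    {w : E} (hw : 3 / 2 * ‖w‖ < R) :
    ‖euler2 V w‖ ≤ 35 / 4 * K * ‖w‖ ^ 3 := by
  have hwR : w ∈ ball (0 : E) R := by
    rw [mem_ball_zero_iff]; nlinarith [norm_nonneg w]
  have hVw : ‖V w‖ ≤ K * ‖w‖ ^ 3 := hK w hwR
  have hD : ‖fderiv ℂ V w w‖ ≤ 27 / 4 * K * ‖w‖ ^ 3 := by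
    by_cases h0 : w = 0
    · subst h0; simp
    have hpos : 0 < ‖w‖ := norm_pos_iff.mpr h0
    have hB := bound_of_cubic hK0 hK hw
    have h := norm_fderiv_apply_le_of_bound hV hw (by linarith : ‖w‖ < 3 / 2 * ‖w‖) hB le_rfl w
    calc ‖fderiv ℂ V w w‖ ≤ K * (3 / 2 * ‖w‖) ^ 3 / (3 / 2 * ‖w‖ - ‖w‖) * ‖w‖ := h
      _ = 27 / 4 * K * ‖w‖ ^ 3 := by
          have hne : ‖w‖ ≠ 0 := hpos.ne'
          field_simp
          ring
  have h2 : ‖(2 : ℂ) • V w‖ ≤ 2 * (K * ‖w‖ ^ 3) := by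
    rw [norm_smul]
    have : ‖(2 : ℂ)‖ = 2 := by simp
    rw [this]
    gcongr
  calc ‖euler2 V w‖ = ‖fderiv ℂ V w w - (2 : ℂ) • V w‖ := rfl
    _ ≤ ‖fderiv ℂ V w w‖ + ‖(2 : ℂ) • V w‖ := norm_sub_le _ _
    _ ≤ 27 / 4 * K * ‖w‖ ^ 3 + 2 * (K * ‖w‖ ^ 3) := add_le_add hD h2
    _ = 35 / 4 * K * ‖w‖ ^ 3 := by ring

/-- The cubic bound for (w∂_w − 2)V in the ball form: on `ball 0 (2R/3)`. [folklore] -/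
theorem cubic_euler2 {V : E → F} {R K : ℝ} (hK0 : 0 ≤ K)
    (hV : DifferentiableOn ℂ V (ball 0 R))
    (hK : ∀ z ∈ ball (0 : E) R, ‖V z‖ ≤ K * ‖z‖ ^ 3) :
    ∀ w ∈ ball (0 : E) (2 / 3 * R), ‖euler2 V w‖ ≤ 35 / 4 * K * ‖w‖ ^ 3 := by
  intro w hw
  rw [mem_ball_zero_iff] at hw
  exact norm_euler2_le hK0 hV hK (by linarith)

/-- (w∂_w − 2)V is analytic where `V` is (open domain): `w ↦ DV(w)w` is the evaluation bilinear map composed with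
`w ↦ (w, DV(w))`. [folklore] -/
theorem analyticOnNhd_euler2 {V : E → F} {U : Set E} (hV : AnalyticOnNhd ℂ V U) (hU : IsOpen U) :
    AnalyticOnNhd ℂ (euler2 V) U := by
  intro z hz
  have h1 : AnalyticAt ℂ (fderiv ℂ V) z := (hV.fderiv_of_isOpen hU) z hz
  have h2 : AnalyticAt ℂ (fun y : E => fderiv ℂ V y y) z := by
    have hb := (ContinuousLinearMap.apply ℂ F : E →L[ℂ] (E →L[ℂ] F) →L[ℂ] F).analyticAt_bilinear
      (z, fderiv ℂ V z)
    have hp : AnalyticAt ℂ (fun y : E => (y, fderiv ℂ V y)) z := analyticAt_id.prod h1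
    have hc : AnalyticAt ℂ
        ((fun q : E × (E →L[ℂ] F) => (ContinuousLinearMap.apply ℂ F : E →L[ℂ] (E →L[ℂ] F) →L[ℂ] F) q.1 q.2)
          ∘ (fun y : E => (y, fderiv ℂ V y))) z :=
      AnalyticAt.comp (f := fun y : E => (y, fderiv ℂ V y)) (x := z) hb hp
    refine hc.congr (Eventually.of_forall fun y => ?_)
    simp [Function.comp]
  have h3 : AnalyticAt ℂ (fun y : E => (2 : ℂ) • V y) z := analyticAt_const.smul (hV z hz)
  have h4 := h2.sub h3
  exact h4

/-- Third derivative under the cubic bound, explicit shells: `‖p‖ ≤ β`, `0 < s`, `β + 3s < R` ⇒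
`‖∂_x∂_u∂_v f(p)‖ ≤ K(β + 3s)³‖x‖‖u‖‖v‖/s³`. [folklore] -/
theorem norm_d3_le_of_cubic_aux {f : E → F} {R K β s : ℝ} (hK0 : 0 ≤ K)
    (hf : AnalyticOnNhd ℂ f (ball 0 R))
    (hK : ∀ z ∈ ball (0 : E) R, ‖f z‖ ≤ K * ‖z‖ ^ 3)
    (hs : 0 < s) (hR : β + 3 * s < R) {p : E} (hp : ‖p‖ ≤ β) (x u v : E) :
    ‖d3 f p x u v‖ ≤ K * (β + 3 * s) ^ 3 / s ^ 3 * ‖x‖ * ‖u‖ * ‖v‖ := by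
  have hB := bound_of_cubic hK0 hK hR
  have h := norm_d3_le_of_bound hf hR (by linarith : β < β + s) (by linarith : β + s < β + 2 * s)
    (by linarith : β + 2 * s < β + 3 * s) hB hp x u v
  have e1 : β + 3 * s - (β + 2 * s) = s := by ring
  have e2 : β + 2 * s - (β + s) = s := by ring
  have e3 : β + s - β = s := by ring
  rw [e1, e2, e3] at h
  calc ‖d3 f p x u v‖ ≤ K * (β + 3 * s) ^ 3 / s / s / s * ‖x‖ * ‖u‖ * ‖v‖ := h
    _ = K * (β + 3 * s) ^ 3 / s ^ 3 * ‖x‖ * ‖u‖ * ‖v‖ := by ring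

/-- **Absolute third-derivative bound.**  Cubic bound `K` on `ball 0 R`, `f` analytic there, `4‖p‖ ≤ R`, `R > 0` ⇒
`‖∂_x∂_u∂_v f(p)‖ ≤ 64K‖x‖‖u‖‖v‖` — NO factor ‖p‖ (shells R/4 < R/4 + s < R/4 + 2s < R/4 + 3s, s ↑ R/4, sup KR³).
[folklore] -/
theorem norm_d3_le_of_cubic {f : E → F} {R K : ℝ} (hK0 : 0 ≤ K)
    (hf : AnalyticOnNhd ℂ f (ball 0 R))
    (hK : ∀ z ∈ ball (0 : E) R, ‖f z‖ ≤ K * ‖z‖ ^ 3)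
    (hRpos : 0 < R) {p : E} (hp : 4 * ‖p‖ ≤ R) (x u v : E) :
    ‖d3 f p x u v‖ ≤ 64 * K * ‖x‖ * ‖u‖ * ‖v‖ := by
  have hp' : ‖p‖ ≤ R / 4 := by linarith
  have key : ∀ s ∈ Ioo 0 (R / 4), ‖d3 f p x u v‖ ≤ K * (R / 4 + 3 * s) ^ 3 / s ^ 3 * ‖x‖ * ‖u‖ * ‖v‖ :=
    fun s hs => norm_d3_le_of_cubic_aux hK0 hf hK hs.1 (by linarith [hs.2]) hp' x u v
  have hR4 : (R / 4) ^ 3 ≠ 0 := by positivity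
  have hcont : Tendsto (fun s : ℝ => K * (R / 4 + 3 * s) ^ 3 / s ^ 3 * ‖x‖ * ‖u‖ * ‖v‖) (𝓝[<] (R / 4))
      (𝓝 (K * (R / 4 + 3 * (R / 4)) ^ 3 / (R / 4) ^ 3 * ‖x‖ * ‖u‖ * ‖v‖)) := by
    have : ContinuousAt (fun s : ℝ => K * (R / 4 + 3 * s) ^ 3 / s ^ 3 * ‖x‖ * ‖u‖ * ‖v‖) (R / 4) := by
      fun_prop (disch := exact hR4)
    exact this.tendsto.mono_left nhdsWithin_le_nhds
  have hev : ∀ᶠ s in 𝓝[<] (R / 4), ‖d3 f p x u v‖ ≤ K * (R / 4 + 3 * s) ^ 3 / s ^ 3 * ‖x‖ * ‖u‖ * ‖v‖ := by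
    filter_upwards [Ioo_mem_nhdsLT (by linarith : (0 : ℝ) < R / 4)] with s hs using key s hs
  have h := ge_of_tendsto hcont hev
  calc ‖d3 f p x u v‖ ≤ K * (R / 4 + 3 * (R / 4)) ^ 3 / (R / 4) ^ 3 * ‖x‖ * ‖u‖ * ‖v‖ := h
    _ = 64 * K * ‖x‖ * ‖u‖ * ‖v‖ := by
        have hR' : R ≠ 0 := hRpos.ne'
        field_simp
        ring

/-- The third-order integral-remainder coefficient of AN4 (P1)(i): `K₃ = ∫₀¹ ½(1 − t)² ∂_x∂_u∂_v W(tw) dt`. [folklore] -/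
def coeff3 (W : E → F) (w x u v : E) : F :=
  ∫ t in (0 : ℝ)..1, ((1 - t) ^ 2 / 2) • d3 W ((t : ℂ) • w) x u v

/-- `∫₀¹ ½(1 − t)²·c dt = c/6`. [folklore] -/
theorem integral_half_one_sub_sq_mul (c : ℝ) : ∫ t in (0 : ℝ)..1, (1 - t) ^ 2 / 2 * c = 1 / 6 * c := by
  have hF : ∀ t ∈ Set.uIcc (0 : ℝ) 1,
      HasDerivAt (fun t : ℝ => (t / 2 - t ^ 2 / 2 + t ^ 3 / 6) * c) ((1 - t) ^ 2 / 2 * c) t := by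
    intro t _
    have h1 : HasDerivAt (fun t : ℝ => t / 2 - t ^ 2 / 2 + t ^ 3 / 6) ((1 - t) ^ 2 / 2) t := by
      refine ((((hasDerivAt_id' t).div_const 2).sub ((hasDerivAt_pow 2 t).div_const 2)).add
        ((hasDerivAt_pow 3 t).div_const 6)).congr_deriv ?_
      push_cast
      ring
    exact h1.mul_const c
  have hint : IntervalIntegrable (fun t : ℝ => (1 - t) ^ 2 / 2 * c) MeasureTheory.volume 0 1 := by
    apply Continuous.intervalIntegrable; fun_prop
  rw [intervalIntegral.integral_eq_sub_of_hasDerivAt hF hint]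
  ring

/-- **Absolute bound on the third-order coefficients.**  `W` analytic on `ball 0 R` with cubic constant `K` ⇒ for
`4‖w‖ ≤ R` and directions of norm ≤ 1: `‖∫₀¹ ½(1 − t)² ∂_x∂_u∂_v W(tw) dt‖ ≤ (1/6)·64K = (32/3)K`. [folklore] -/
theorem norm_coeff3_le {W : E → F} {R K : ℝ} (hK0 : 0 ≤ K)
    (hW : AnalyticOnNhd ℂ W (ball 0 R))
    (hK : ∀ z ∈ ball (0 : E) R, ‖W z‖ ≤ K * ‖z‖ ^ 3)
    (hRpos : 0 < R) {w : E} (hw : 4 * ‖w‖ ≤ R) {x u v : E} (hx : ‖x‖ ≤ 1) (hu : ‖u‖ ≤ 1) (hv : ‖v‖ ≤ 1) :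
    ‖coeff3 W w x u v‖ ≤ 1 / 6 * (64 * K) := by
  have hpt : ∀ t : ℝ, t ∈ Set.Ioc (0 : ℝ) 1 →
      ‖((1 - t) ^ 2 / 2) • d3 W ((t : ℂ) • w) x u v‖ ≤ (1 - t) ^ 2 / 2 * (64 * K) := by
    intro t ht
    have ht0 : 0 ≤ t := ht.1.le
    have ht1 : t ≤ 1 := ht.2
    have hp : 4 * ‖(t : ℂ) • w‖ ≤ R := by
      rw [norm_smul, Complex.norm_real, Real.norm_of_nonneg ht0]
      calc 4 * (t * ‖w‖) ≤ 4 * (1 * ‖w‖) := by gcongr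
        _ = 4 * ‖w‖ := by ring
        _ ≤ R := hw
    have h := norm_d3_le_of_cubic hK0 hW hK hRpos hp x u v
    have h64 : 64 * K * ‖x‖ * ‖u‖ * ‖v‖ ≤ 64 * K := by
      have h1 : 64 * K * ‖x‖ * ‖u‖ * ‖v‖ ≤ 64 * K * 1 * 1 * 1 := by gcongr
      simpa using h1
    rw [norm_smul, Real.norm_of_nonneg (by positivity)]
    exact mul_le_mul_of_nonneg_left (h.trans h64) (by positivity)
  have hint : IntervalIntegrable (fun t : ℝ => (1 - t) ^ 2 / 2 * (64 * K)) MeasureTheory.volume 0 1 := by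
    apply Continuous.intervalIntegrable; fun_prop
  have h1 := intervalIntegral.norm_integral_le_of_norm_le zero_le_one (Eventually.of_forall hpt) hint
  calc ‖coeff3 W w x u v‖ ≤ ∫ t in (0 : ℝ)..1, (1 - t) ^ 2 / 2 * (64 * K) := h1
    _ = 1 / 6 * (64 * K) := integral_half_one_sub_sq_mul _

/-- **AN4 §4 (P1)(i), kernel form.**  For the term (1.38) `Fk` (analytic on the polydisc, (1.39) with `C₃ ≥ 0`,
`a₁ > 0`): the third-order integral-remainder coefficients of `W = (w∂_w − 2)Fk` — the function whose value at
`w = g_kY`, divided by g_k³, is `∂_{g_k}[(1/g_k²)Fk(g_kY)]` (`hasDerivAt_inv_sq_smul`) — satisfy, for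
`e^{16κ₁}‖B′‖ ≤ a₁/6` and coordinate directions of norm ≤ 1,
`‖∫₀¹ ½(1 − t)² ∂_x∂_u∂_v W(tB′) dt‖ ≤ (280/3)·C₃e^{48κ₁}·M⁴exp(−(κ₁ − 1)M⁻⁴|Y∖□|)`: an ABSOLUTE multiple of the
constant of (1.39) — no factor |B′| (→ C₁ε₁), in contrast with the second-order coefficients (1.40).  (Cell document
`HOME/BETA/AN4.md` §4 (P1)(i), [analysis] → [kernel]; the located open estimate (P1)(ii) is untouched.)
[cite: Balaban1988RG2Cluster, (1.39) p.10] -/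
theorem an4_P1i {Fk : E → F} {κ₁ a₁ C₃ M nYc : ℝ} (ha₁ : 0 < a₁) (hC₃ : 0 ≤ C₃)
    (hF : AnalyticOnNhd ℂ Fk (ball 0 (rad κ₁ a₁))) (h139 : Ineq139 Fk κ₁ a₁ C₃ M nYc)
    {B' : E} (hB' : Real.exp (16 * κ₁) * ‖B'‖ ≤ a₁ / 6)
    {x u v : E} (hx : ‖x‖ ≤ 1) (hu : ‖u‖ ≤ 1) (hv : ‖v‖ ≤ 1) :
    ‖coeff3 (euler2 Fk) B' x u v‖ ≤
      280 / 3 * (C₃ * Real.exp (48 * κ₁) * (M ^ 4 * Real.exp (-(κ₁ - 1) * nYc))) := by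
  set K : ℝ := C₃ * Real.exp (48 * κ₁) * (M ^ 4 * Real.exp (-(κ₁ - 1) * nYc)) with hK
  have hM4 : 0 ≤ M ^ 4 := by positivity
  have hK0 : 0 ≤ K := by positivity
  have hcubic := cubic_of_139 h139
  have hR := rad_pos (κ₁ := κ₁) ha₁
  -- W = (w∂_w − 2)Fk: analytic on the polydisc, cubic constant (35/4)K on the ball of radius (2/3)·rad
  have hWan : AnalyticOnNhd ℂ (euler2 Fk) (ball 0 (2 / 3 * rad κ₁ a₁)) :=
    (analyticOnNhd_euler2 hF isOpen_ball).mono (Metric.ball_subset_ball (by linarith))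
  have hWcubic := cubic_euler2 hK0 hF.differentiableOn hcubic
  have hK0' : 0 ≤ 35 / 4 * K := by positivity
  have hw : 4 * ‖B'‖ ≤ 2 / 3 * rad κ₁ a₁ := by
    have h6 := mul_norm_le_rad (by norm_num : (0 : ℝ) < 6) hB'
    linarith
  have h := norm_coeff3_le hK0' hWan hWcubic (by linarith) hw hx hu hv
  calc ‖coeff3 (euler2 Fk) B' x u v‖ ≤ 1 / 6 * (64 * (35 / 4 * K)) := h
    _ = 280 / 3 * K := by ring

end Euler

end Literature.MathematicalPhysics.QuantumFieldTheory.Balaban1983to89.B13Ineq140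

end
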